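import Mathlib
import HarnessLib
import Summits.Langlands.Langlands.Theses.QuarterDeficit1951
import Summits.Langlands.Langlands.Theorems.QuarterDeficit1951QuarterFingerprintDeficitStubOddConstantTerms
import Summits.Langlands.Langlands.Theorems.QuarterDeficit1951QuarterFingerprintDeficitStubReflectLaplacian
import Summits.Langlands.Langlands.Theorems.QuarterDeficit1951QuarterFingerprintDeficitStubReflectAutomorphyHecke
import Summits.Langlands.Langlands.Theorems.QuarterDeficit1951QuarterFingerprintDeficitStubEisensteinEven
import Summits.Langlands.Langlands.Theorems.QuarterDeficit1951QuarterFingerprintDeficitStubParityClosure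
import Summits.Langlands.Langlands.Theorems.QuarterFingerprintDeficit.Negative.QuarterFingerprintDeficitFalseOfOddWindowCertificate

/-!
# Line `Sketch` — lead c2 RESHAPE (2026-08-17): the parity cut (= strategist alt line `ParityPurePoint`)
crux stmt-Langlands-15897 `Summit.Langlands.Langlands.Theses.QuarterDeficit1951.QuarterFingerprintDeficit` (C1)

REFUTATION-FIRST line: the composition concludes `¬ QuarterFingerprintDeficit` (C1 is numerically FALSE — lead c0's
Hejhal `r = 0` sighting of ODD `λ = 1/4` newforms for all four order-5 `χ`, Cruxes/QuarterFingerprintDeficit/SightingHejhalR0.md;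
what remains is a CERTIFICATE, verdict class computation). The original `Sketch` skeleton (planner, 2026-08-16) had ONE decisive
stub D = `EvenIcosahedralMaassFormAt1951` (λ = 1/4 and fingerprint EXACT; glue `H → ¬C1` landed p128419; abstract stubs landed
p128153/p128205/p128255). Exactness is not certifiable by any finite computation, so lead c2 re-cut D DOWNWARD to the literal
output of a ball-arithmetic certificate (`OddWindowCertificate`, P4, LANDED as the hypothesis of the negative lemma
`QuarterFingerprintDeficit_false_of_OddWindowCertificate`, p158019) using the parity lever below; the Lean share grew by
P1–P3 and S1, ALL LANDED in wave 1 (p157357, p157303, p157343, p157390, p158344).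

STATE (2026-08-17, after wave 1): stubs CLOSED — P1 `stub_oddConstantTerms` (p157357), P2a `stub_reflect_laplacian`
(p157303), P2b `stub_reflect_automorphy_hecke` (p157343), P3 `stub_eisenstein_even` (p157390), S1 `stub_parityClosure`
(p158344); OPEN — P4 `stub_oddWindowCertificate` (DECISIVE, computational, lead: Hejhal re-solve + Arb quasimode certificate
in the odd sector), S2 `stub_deficitOdd` (EXPECTED FALSE = the refutation target in positive dress), S3 `stub_deficitEven`
(moot for the refutation). The only `sorry`s below are P4, S2, S3.

LEVER (transfer of the level-1 parity remark to `(Γ₀(1951), χ)`): an order-5 character mod 1951 is EVEN and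
1951 is PRIME, so the Eisenstein series of `(Γ₀(1951), χ)` are exactly `E_∞ = E_{1,χ}` and `E_0 = E_{χ,1}`
(Young 2019), and BOTH are invariant under the reflection `R : z ↦ -z̄` (Mathlib: `UpperHalfPlane.J • z`):
reindex `(c, d) ↦ (c, -d)` and use `χ(-1) = 1` (P3); `R` commutes with the Fricke involution. Hence the `R`-ODD part of
`L²(Γ₀(1951)\ℍ, χ)` has NO continuous (and no residual) spectrum: it is spanned by odd Maass CUSP forms. The sighted
Doud–Moore forms are odd. Consequences: (i) NO Eisenstein annihilator is needed in the quasimode certificate; (ii) odd +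
automorphic ⇒ BOTH constant-term clauses of the crux's `IsForm` (P1, LOAD-BEARING); (iii) the decisive stub is what a
ball-arithmetic certificate literally delivers — an odd form with `|λ − 1/4| ≤ 1/100` and Hecke boxes
`r_p (2|a_p| + r_p) ≤ 1/100` around exact centres `a_p` (`a_p² χ̄(p) ∈ Φ`).
Disproof used: honours `quarterFingerprintDeficit_false_without_nonzero` (the witness carries `∃ z, u z ≠ 0`);
consistent with `not_deficit_iff_windowSighting` (P1 ∧ P4 produce exactly a `WindowSighting`).
-/

set_option linter.dupNamespace false

noncomputable section

namespace Summit.Langlands.Langlands.Cruxes.QuarterFingerprintDeficit.LineSketch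

open Summit.Langlands.Langlands.Theses.QuarterDeficit1951
open Summit.Langlands.Langlands.Theorems.QuarterFingerprintDeficit (IsForm Tp P₀ ParityClosure)
open Summit.Langlands.Langlands.Theorems.QuarterFingerprintDeficit.Negative (OddWindowCertificate
  QuarterFingerprintDeficit_false_of_OddWindowCertificate)
open scoped BigOperators ComplexConjugate MatrixGroups
open UpperHalfPlane (J ofComplex)

/-! ## 1. Stubs P1–P3 (CLOSED: sorry-free aliases of the landed theorems, same registered signatures) -/

/-- STUB P1 (CLOSED, p157357; LOAD-BEARING): odd + `Γ₀(1951)`-automorphic ⇒ both constant-term clauses vanish. -/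
theorem stub_oddConstantTerms (χ : DirichletCharacter ℂ 1951) (u : UpperHalfPlane → ℂ)
    (haut : ∀ γ : Matrix.SpecialLinearGroup (Fin 2) ℤ, γ ∈ CongruenceSubgroup.Gamma0 1951 →
      ∀ z : UpperHalfPlane, u (γ • z) = χ ((γ 1 1 : ℤ) : ZMod 1951) * u z)
    (hodd : ∀ z : UpperHalfPlane, u (UpperHalfPlane.J • z) = - u z) :
    (∀ y : ℝ, 0 < y → ∫ x in (0 : ℝ)..1, u (UpperHalfPlane.ofComplex (x + y * Complex.I)) = 0) ∧
    (∀ y : ℝ, 0 < y →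
      ∫ x in (0 : ℝ)..1951, u (ModularGroup.S • UpperHalfPlane.ofComplex (x + y * Complex.I)) = 0) :=
  Summit.Langlands.Langlands.Theorems.QuarterFingerprintDeficit.stub_oddConstantTerms χ u haut hodd

/-- STUB P2a (CLOSED, p157303): `IsC2`/`hypLaplacian` transport under `R`. -/
theorem stub_reflect_laplacian (u : UpperHalfPlane → ℂ) (hu : Literature.NumberTheory.Automorphic.IsC2 u) :
    Literature.NumberTheory.Automorphic.IsC2 (fun z => u (UpperHalfPlane.J • z)) ∧
    ∀ z : UpperHalfPlane,
      Literature.NumberTheory.Automorphic.hypLaplacian (fun w => u (UpperHalfPlane.J • w)) z =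
      Literature.NumberTheory.Automorphic.hypLaplacian u (UpperHalfPlane.J • z) :=
  Summit.Langlands.Langlands.Theorems.QuarterFingerprintDeficit.stub_reflect_laplacian u hu

/-- STUB P2b (CLOSED, p157343): automorphy with the same character and the crux's `T_p` commute with `R`. -/
theorem stub_reflect_automorphy_hecke (χ : DirichletCharacter ℂ 1951) (u : UpperHalfPlane → ℂ)
    (haut : ∀ γ : Matrix.SpecialLinearGroup (Fin 2) ℤ, γ ∈ CongruenceSubgroup.Gamma0 1951 →
      ∀ z : UpperHalfPlane, u (γ • z) = χ ((γ 1 1 : ℤ) : ZMod 1951) * u z) :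
    (∀ γ : Matrix.SpecialLinearGroup (Fin 2) ℤ, γ ∈ CongruenceSubgroup.Gamma0 1951 →
      ∀ z : UpperHalfPlane, u (UpperHalfPlane.J • (γ • z)) = χ ((γ 1 1 : ℤ) : ZMod 1951) * u (UpperHalfPlane.J • z)) ∧
    ∀ p ∈ ({2, 3, 5, 7, 11, 13} : Finset ℕ), ∀ z : UpperHalfPlane,
      ((Real.sqrt p : ℝ) : ℂ)⁻¹ *
        ((∑ b ∈ Finset.range p, u (UpperHalfPlane.J • UpperHalfPlane.ofComplex (((z : ℂ) + b) / p))) +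
          χ (p : ZMod 1951) * u (UpperHalfPlane.J • UpperHalfPlane.ofComplex ((p : ℂ) * z))) =
      ((Real.sqrt p : ℝ) : ℂ)⁻¹ *
        ((∑ b ∈ Finset.range p, u (UpperHalfPlane.ofComplex (((↑(UpperHalfPlane.J • z) : ℂ) + b) / p))) +
          χ (p : ZMod 1951) * u (UpperHalfPlane.ofComplex ((p : ℂ) * ↑(UpperHalfPlane.J • z)))) :=
  Summit.Langlands.Langlands.Theorems.QuarterFingerprintDeficit.stub_reflect_automorphy_hecke χ u haut

/-- STUB P3 (CLOSED, p157390): the weight-0 Eisenstein `tsum` of `(Γ₀(N), χ)`, `χ` even, is `R`-invariant. -/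
theorem stub_eisenstein_even (N : ℕ) (χ : DirichletCharacter ℂ N) (hχ : χ (-1) = 1) (s : ℝ)
    (z : UpperHalfPlane) :
    (∑' v : {v : Fin 2 → ℤ // IsCoprime (v 0) (v 1) ∧ (N : ℤ) ∣ v 0},
      (χ ((v.1 1 : ℤ) : ZMod N))⁻¹ *
        (((UpperHalfPlane.im (UpperHalfPlane.J • z)) ^ s /
          ‖((v.1 0 : ℤ) : ℂ) * ((↑(UpperHalfPlane.J • z)) : ℂ) + ((v.1 1 : ℤ) : ℂ)‖ ^ (2 * s) : ℝ) : ℂ)) =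
    ∑' v : {v : Fin 2 → ℤ // IsCoprime (v 0) (v 1) ∧ (N : ℤ) ∣ v 0},
      (χ ((v.1 1 : ℤ) : ZMod N))⁻¹ *
        (((UpperHalfPlane.im z) ^ s / ‖((v.1 0 : ℤ) : ℂ) * (z : ℂ) + ((v.1 1 : ℤ) : ℂ)‖ ^ (2 * s) : ℝ) : ℂ) :=
  Summit.Langlands.Langlands.Theorems.QuarterFingerprintDeficit.stub_eisenstein_even N χ hχ s z

/-! ## 2. The decisive computational stub P4 and the refutation composition -/

/-- STUB P4 (DECISIVE, computational — lead; NOT a proving task): the odd-sector window certificate at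
`(1951, χ₁)` — `OddWindowCertificate` is the LANDED def (p158019) in
Theorems/QuarterFingerprintDeficit/Negative/QuarterFingerprintDeficitFalseOfOddWindowCertificate.lean: an order-5 `χ`,
an odd bounded `C²` automorphic eigenfunction `u ≢ 0` with `|λ − 1/4| ≤ 1/100`, Hecke boxes `‖μ_p − a_p‖ ≤ r_p` with
`a_p² χ̄(p) ∈ Φ`, `r_p (2‖a_p‖ + r_p) ≤ 1/100`. Never provable in-kernel without the spectral theory of
`L²(Γ₀(N)\ℍ, χ)`; decided by the lead's Arb certificate (Hejhal re-solve → exact ℤ[ζ₅] trial vector → quasimode). -/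
theorem stub_oddWindowCertificate : OddWindowCertificate := by
  sorry

/-- COMPOSITION (sorry-free modulo P4): the landed negative lemma `OddWindowCertificate → ¬ C1` (p158019; it uses
the landed P1 internally) applied to P4 — the conclusion is literally `¬ C1`. -/
theorem not_QuarterFingerprintDeficit : ¬ QuarterFingerprintDeficit :=
  QuarterFingerprintDeficit_false_of_OddWindowCertificate stub_oddWindowCertificate

/-! ## 3. Proof-direction decomposition (registered for the skeleton audit): the PARITY SPLIT
`ParityClosure → DeficitOdd → DeficitEven → QuarterFingerprintDeficit` (strategist D1; glue sorry-free below).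
`IsForm`, `Tp`, `P₀`, `ParityClosure` are the LANDED defs of
Theorems/QuarterDeficit1951QuarterFingerprintDeficitStubParityClosure.lean (verbatim copies of the crux's `let`s);
`DeficitOdd` is the sharpened refutation target (numerically FALSE: the sighted forms are odd); `DeficitEven`
quarantines the Eisenstein-laden half; `ParityClosure` is TRUE and LANDED (S1, p158344). -/

/-- `Φ = {0, 1, 4, (3 ± √5)/2}` — projective fingerprint values `tr²/det` at elements of order 1,2,3,5. -/
def Φ : Set ℂ := {0, 1, 4, (((3 + Real.sqrt 5) / 2 : ℝ) : ℂ), (((3 - Real.sqrt 5) / 2 : ℝ) : ℂ)}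

/-- The crux's windowed fingerprint clause at the six primes (over the landed `Tp`, `P₀`). -/
def Fingerprint (χ : DirichletCharacter ℂ 1951) (u : UpperHalfPlane → ℂ) : Prop :=
  ∀ p ∈ P₀, ∃ μ φ : ℂ, φ ∈ Φ ∧ (∀ z, Tp χ p u z = μ * u z) ∧
    ‖μ ^ 2 * (starRingEnd ℂ) (χ (p : ZMod 1951)) - φ‖ ≤ 1 / 100

/-- SUB-CRUX `DeficitOdd`: C1 restricted to witnesses ODD under `R : z ↦ -z̄`. EXPECTED FALSE (refutation target:
the sighted λ = 1/4 Doud–Moore newforms are odd); its refutation refutes C1 (`deficitOdd_of_deficit`). -/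
def DeficitOdd : Prop :=
  ∀ χ : DirichletCharacter ℂ 1951, orderOf χ = 5 → ¬ ∃ (u : UpperHalfPlane → ℂ) (lam : ℝ),
    IsForm χ u lam ∧ (∀ z, u (J • z) = - u z) ∧ (∃ z, u z ≠ 0) ∧ |lam - 1 / 4| ≤ 1 / 100 ∧ Fingerprint χ u

/-- SUB-CRUX `DeficitEven`: C1 restricted to witnesses EVEN under `R`. Plausibly true; certifiable only by an
even-sector census; moot for the route once `DeficitOdd` is refuted. -/
def DeficitEven : Prop :=
  ∀ χ : DirichletCharacter ℂ 1951, orderOf χ = 5 → ¬ ∃ (u : UpperHalfPlane → ℂ) (lam : ℝ),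
    IsForm χ u lam ∧ (∀ z, u (J • z) = u z) ∧ (∃ z, u z ≠ 0) ∧ |lam - 1 / 4| ≤ 1 / 100 ∧ Fingerprint χ u

/-- STUB S1 (CLOSED, p158344): parity closure of the witness class (the landed `ParityClosure`). -/
theorem stub_parityClosure : ParityClosure :=
  Summit.Langlands.Langlands.Theorems.QuarterFingerprintDeficit.stub_parityClosure

/-- STUB S2 (EXPECTED FALSE — the refutation target in positive dress, NOT a proving task): no odd fingerprinted window form. -/
theorem stub_deficitOdd : DeficitOdd := by
  sorry

/-- STUB S3 (plausibly true; even-sector census; not needed for the refutation): no even fingerprinted window form. -/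
theorem stub_deficitEven : DeficitEven := by
  sorry

/-- `R` is an involution on `ℍ`. -/
theorem J_smul_J_smul (z : UpperHalfPlane) : J • J • z = z := by
  rw [smul_smul, ← sq, UpperHalfPlane.J_sq, one_smul]

/-- The split implication as a named proposition. -/
def ParitySplitImplication : Prop :=
  ParityClosure → DeficitOdd → DeficitEven → QuarterFingerprintDeficit

/-- THE SPLIT (sorry-free): `ParityClosure → DeficitOdd → DeficitEven → QuarterFingerprintDeficit`.
A crux witness `u ≢ 0` has a nonzero odd part `u − u∘R` or a nonzero even part `u + u∘R`; by `ParityClosure` that part is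
again a witness, of fixed parity. (`IsForm`/`Tp`/`P₀` are verbatim the crux's `let`s, so the crux unfolds to them by `rfl`.) -/
theorem deficit_of_paritySplit : ParitySplitImplication := by
  intro hC hO hE χ hχ hex
  obtain ⟨u, lam, hform, ⟨z₀, hz₀⟩, hwin, hfp⟩ := hex
  obtain ⟨⟨hformO, hformE⟩, hT⟩ := hC χ u lam hform
  have hfpO : Fingerprint χ (fun z => u z - u (J • z)) := by
    intro p hp
    obtain ⟨μ, φ, hφ, hTu, hfin⟩ := hfp p hp
    exact ⟨μ, φ, hφ, (hT p hp μ hTu).1, hfin⟩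
  have hfpE : Fingerprint χ (fun z => u z + u (J • z)) := by
    intro p hp
    obtain ⟨μ, φ, hφ, hTu, hfin⟩ := hfp p hp
    exact ⟨μ, φ, hφ, (hT p hp μ hTu).2, hfin⟩
  by_cases ho : ∃ z, u z - u (J • z) ≠ 0
  · exact hO χ hχ ⟨fun z => u z - u (J • z), lam, hformO,
      fun z => by simp only [J_smul_J_smul]; ring, ho, hwin, hfpO⟩
  · by_cases he : ∃ z, u z + u (J • z) ≠ 0
    · exact hE χ hχ ⟨fun z => u z + u (J • z), lam, hformE,
        fun z => by simp only [J_smul_J_smul]; ring, he, hwin, hfpE⟩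
    · push Not at ho he
      apply hz₀
      have h1 := ho z₀
      have h2 := he z₀
      linear_combination (h1 + h2) / 2

/-- The trivial direction: C1 implies its odd restriction. So a refutation of `DeficitOdd` is a refutation of C1. -/
theorem deficitOdd_of_deficit (h : QuarterFingerprintDeficit) : DeficitOdd := by
  intro χ hχ ⟨u, lam, hform, _hodd, hne, hwin, hfp⟩
  exact h χ hχ ⟨u, lam, hform, hne, hwin, hfp⟩

/-- Likewise for the even restriction. -/
theorem deficitEven_of_deficit (h : QuarterFingerprintDeficit) : DeficitEven := by
  intro χ hχ ⟨u, lam, hform, _hev, hne, hwin, hfp⟩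
  exact h χ hχ ⟨u, lam, hform, hne, hwin, hfp⟩

/-- `C1 ↔ DeficitOdd ∧ DeficitEven` (kernel record of the parity split, using the landed S1). -/
theorem deficit_iff_odd_and_even : QuarterFingerprintDeficit ↔ DeficitOdd ∧ DeficitEven :=
  ⟨fun h => ⟨deficitOdd_of_deficit h, deficitEven_of_deficit h⟩,
    fun h => deficit_of_paritySplit stub_parityClosure h.1 h.2⟩

/-- SKELETON THEOREM (proof direction): the crux BY NAME from the three registered stubs S1–S3. The line itself runs the
refutation direction (`not_QuarterFingerprintDeficit`, §2): S2 is the piece expected to FAIL, by an `OddWindowCertificate`. -/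
theorem QuarterFingerprintDeficit_proof : QuarterFingerprintDeficit :=
  (show ParityClosure → DeficitOdd → DeficitEven → QuarterFingerprintDeficit from deficit_of_paritySplit)
    stub_parityClosure stub_deficitOdd stub_deficitEven

end Summit.Langlands.Langlands.Cruxes.QuarterFingerprintDeficit.LineSketch

end
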